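import Summits.Ventures.QEC.Census.LPBounds.NoCodeK00
import Summits.Ventures.QEC.Census.LPBounds.NoCodeK01To03
import Summits.Ventures.QEC.Census.LPBounds.NoCodeK04To06
import Summits.Ventures.QEC.Census.LPBounds.NoCodeK07To09
import Summits.Ventures.QEC.Census.LPBounds.NoCodeK10To13
import Summits.Ventures.QEC.Census.CSSZeroRate
import Literature.InformationTheory.QuantumCodes.QuantumSingletonBound
import HarnessLib

/-!
# CSS census cells, UPPER column from the additive bounds (part 1: generic lemmas, cells `n ≤ 8`, trivial cells): no CSS code beats the tabulated `d` in 65 of the 90 cells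

LADDER-QEC (venture cell `qec`), CENSUS-PREREG C.2 (CSS calibration grid `n ≤ 12`, qec-search-5
census/search-5/css-n12/CSS-CALIB.tsv: per cell `(n, k)` the best CSS distance `d`, with a CSS-LP certificate that no CSS
`[[n, k, d+1]]` exists — tier COMPUTED). This file is the part of the UPPER column that is ALREADY a theorem: a CSS code is
an additive (stabilizer) code (type-02 `CSSCode.isAdditiveCode_toSympCode`, Literature/…/CSSStabilizer.lean), so wherever
the CSS-LP value coincides with the additive bound of CRSS 1998 Table III the unconditional KERNEL-std nonexistence
theorems `Summit.Ventures.QEC.Census.NoCode.noCode_n_k : ¬ AdditiveCodeExists n k (d+1)` of qec-type-06 (Census/LPBounds/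
NoCodeK*.lean; CRSS Thm. 21 LP via qec-type-01's MacWilliams proof, Rains shadow LP for `k = 0` via qec-type-03) bound
EVERY CSS code of that cell:

* generic: `css_min_dX_dZ_lt_of_not_additiveCodeExists` (`¬ [[n,k,D]]` additive ⇒ every CSS code on `n` qubits with
  `k` logical qubits has `min (d^X, d^Z) < D`) and, for `k = 0` (CRSS convention: `d` = least nonzero stabilizer
  weight), `css_exists_stabilizer_lt_of_not_additiveCodeExists` (some nonzero stabilizer of weight `< D`);
* per cell (60 cells): `cssUpper_<n>_<k>` — `∀ C : CSSCode RX RZ (Fin n), C.k = k → min C.dX C.dZ ≤ d` (`k ≥ 1`) /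
  `… C.k = 0 → ∃ v ∈ C.toSympCode, v ≠ 0 ∧ sympWeight v ≤ d` (`k = 0`), `d` = the CSS-CALIB value;
* the 5 trivial cells `n ≤ 2` (no Table III entry): from the quantum Singleton bound
  (`AdditiveCodeExists.quantumSingleton`, Literature/…/QuantumSingletonBound.lean, qec-lit-4) for `k ≥ 1` and from
  `sympWeight ≤ n` for `k = 0`.

Together with the LOWER column (Census/CSS/CalibCSS*.lean: the tabulated instance IS `[[n,k,d]]`) these 65
cells of C.2 are theorems cell by cell. NOT covered here (honest framing): the 25 cells where the best CSS code is
STRICTLY worse than the best additive code — (5,0), (5,1), (6,0), (6,1), (7,0), (8,2), (8,3), (9,0), (9,2), (9,3), (10,1), (10,2), (10,3), (10,4), (11,0), (11,1), (11,2), (11,4), (11,5), (12,0), (12,1), (12,3), (12,4), (12,5), (12,6) — whose upper bound is search-5's CSS-LP (COMPUTED; a kernel version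
needs the CSS-LP soundness theorem, proposed item 02.CSSLP). [folklore] throughout; the bounds cited are CRSS Table III's
(additive) upper entries [cite: CalderbankEtAl1998, §8 Table III (printed pp. 32–34)].
-/

namespace Summit.Ventures.QEC.Census.CSS

open Summit.Ventures.QEC.Census Summit.Ventures.QEC.Census.NoCode Literature.InformationTheory.QuantumCodes

/-! ## Generic transport: additive nonexistence bounds every CSS code -/

/-- **No additive `[[n, k, D]]` ⇒ every CSS code on `n` qubits with `k` logical qubits has `min (d^X, d^Z) < D`**
(a CSS code is an `[[n, k, min(d^X,d^Z)]]` additive code, `CSSCode.isAdditiveCode_toSympCode`, and the parameter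
predicate is monotone in `d`). [folklore] -/
theorem css_min_dX_dZ_lt_of_not_additiveCodeExists {n k D : ℕ} (h : ¬ AdditiveCodeExists n k D)
    {RX RZ : Type*} [Fintype RX] [Fintype RZ] (C : CSSCode RX RZ (Fin n)) (hk : C.k = k) : min C.dX C.dZ < D := by
  by_contra hge
  rw [not_lt] at hge
  exact h ⟨C.toSympCode, hk ▸ (C.isAdditiveCode_toSympCode.mono hge)⟩

/-- **No additive `[[n, 0, D]]` ⇒ every zero-rate CSS code on `n` qubits has a nonzero stabilizer of weight `< D`**
(CRSS's `k = 0` convention; contrapositive: if all nonzero stabilizers had weight `≥ D`, `S̄ = rs H^X × rs H^Z` would be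
an `[[n, 0, D]]` additive code — self-dual with no logical operator, `css_hasMinDist_of_k_eq_zero`). [folklore] -/
theorem css_exists_stabilizer_lt_of_not_additiveCodeExists {n D : ℕ} (h : ¬ AdditiveCodeExists n 0 D)
    {RX RZ : Type*} [Fintype RX] [Fintype RZ] (C : CSSCode RX RZ (Fin n)) (hk : C.k = 0) :
    ∃ v ∈ C.toSympCode, v ≠ 0 ∧ sympWeight v < D := by
  by_contra hall
  push Not at hall
  have hdim : Module.finrank (ZMod 2) C.toSympCode + 0 = n := by
    have h' := C.finrank_toSympCode_add_k
    rw [hk] at h'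
    exact h'
  exact h ⟨C.toSympCode, C.isSelfOrthogonal_toSympCode, hdim, css_hasMinDist_of_k_eq_zero C hk D,
    fun _ v hv hv0 => hall v hv hv0⟩

/-- A zero-rate CSS code on `n ≥ 1` qubits has a nonzero stabilizer, and its weight is at most `n` (used for the
trivial cells `n ≤ 2`). [folklore] -/
theorem css_exists_stabilizer_le_card {n : ℕ} (hn : 1 ≤ n) {RX RZ : Type*} [Fintype RX] [Fintype RZ]
    (C : CSSCode RX RZ (Fin n)) (hk : C.k = 0) : ∃ v ∈ C.toSympCode, v ≠ 0 ∧ sympWeight v ≤ n := by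
  have hdim : 0 < Module.finrank (ZMod 2) C.toSympCode := by
    have h' := C.finrank_toSympCode_add_k
    rw [hk] at h'
    omega
  have hne : C.toSympCode ≠ ⊥ := by
    intro h0
    rw [h0, finrank_bot] at hdim
    exact lt_irrefl 0 hdim
  obtain ⟨v, hv, hv0⟩ := Submodule.exists_mem_ne_zero_of_ne_bot hne
  exact ⟨v, hv, hv0, sympWeight_le v⟩

/-! ## The cells (`d` = CSS-CALIB value; bound = CRSS Table III additive upper entry via `noCode_n_k`) -/

/-- Cell `(n, k) = (3, 0)`: every zero-rate CSS code on `3` qubits has a nonzero stabilizer of weight `≤ 2` (CRSS `k = 0`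
convention; `noCode_3_0 : ¬ [[3,0,3]]`). [folklore] -/
theorem cssUpper_3_0 {RX RZ : Type*} [Fintype RX] [Fintype RZ] (C : CSSCode RX RZ (Fin 3)) (hk : C.k = 0) :
    ∃ v ∈ C.toSympCode, v ≠ 0 ∧ sympWeight v ≤ 2 := by
  obtain ⟨v, hv, hv0, hlt⟩ := css_exists_stabilizer_lt_of_not_additiveCodeExists noCode_3_0 C hk
  exact ⟨v, hv, hv0, Nat.lt_succ_iff.1 hlt⟩

/-- Cell `(n, k) = (3, 1)`: every CSS code on `3` qubits with `k = 1` has `min (d^X, d^Z) ≤ 1` — the CSS-CALIB value is optimal among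
CSS codes because it is optimal among all additive codes (`noCode_3_1 : ¬ [[3,1,2]]`). [folklore] -/
theorem cssUpper_3_1 {RX RZ : Type*} [Fintype RX] [Fintype RZ] (C : CSSCode RX RZ (Fin 3)) (hk : C.k = 1) :
    min C.dX C.dZ ≤ 1 :=
  Nat.lt_succ_iff.1 (css_min_dX_dZ_lt_of_not_additiveCodeExists noCode_3_1 C hk)

/-- Cell `(n, k) = (3, 2)`: every CSS code on `3` qubits with `k = 2` has `min (d^X, d^Z) ≤ 1` — the CSS-CALIB value is optimal among
CSS codes because it is optimal among all additive codes (`noCode_3_2 : ¬ [[3,2,2]]`). [folklore] -/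
theorem cssUpper_3_2 {RX RZ : Type*} [Fintype RX] [Fintype RZ] (C : CSSCode RX RZ (Fin 3)) (hk : C.k = 2) :
    min C.dX C.dZ ≤ 1 :=
  Nat.lt_succ_iff.1 (css_min_dX_dZ_lt_of_not_additiveCodeExists noCode_3_2 C hk)

/-- Cell `(n, k) = (3, 3)`: every CSS code on `3` qubits with `k = 3` has `min (d^X, d^Z) ≤ 1` — the CSS-CALIB value is optimal among
CSS codes because it is optimal among all additive codes (`noCode_3_3 : ¬ [[3,3,2]]`). [folklore] -/
theorem cssUpper_3_3 {RX RZ : Type*} [Fintype RX] [Fintype RZ] (C : CSSCode RX RZ (Fin 3)) (hk : C.k = 3) :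
    min C.dX C.dZ ≤ 1 :=
  Nat.lt_succ_iff.1 (css_min_dX_dZ_lt_of_not_additiveCodeExists noCode_3_3 C hk)

/-- Cell `(n, k) = (4, 0)`: every zero-rate CSS code on `4` qubits has a nonzero stabilizer of weight `≤ 2` (CRSS `k = 0`
convention; `noCode_4_0 : ¬ [[4,0,3]]`). [folklore] -/
theorem cssUpper_4_0 {RX RZ : Type*} [Fintype RX] [Fintype RZ] (C : CSSCode RX RZ (Fin 4)) (hk : C.k = 0) :
    ∃ v ∈ C.toSympCode, v ≠ 0 ∧ sympWeight v ≤ 2 := by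
  obtain ⟨v, hv, hv0, hlt⟩ := css_exists_stabilizer_lt_of_not_additiveCodeExists noCode_4_0 C hk
  exact ⟨v, hv, hv0, Nat.lt_succ_iff.1 hlt⟩

/-- Cell `(n, k) = (4, 1)`: every CSS code on `4` qubits with `k = 1` has `min (d^X, d^Z) ≤ 2` — the CSS-CALIB value is optimal among
CSS codes because it is optimal among all additive codes (`noCode_4_1 : ¬ [[4,1,3]]`). [folklore] -/
theorem cssUpper_4_1 {RX RZ : Type*} [Fintype RX] [Fintype RZ] (C : CSSCode RX RZ (Fin 4)) (hk : C.k = 1) :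
    min C.dX C.dZ ≤ 2 :=
  Nat.lt_succ_iff.1 (css_min_dX_dZ_lt_of_not_additiveCodeExists noCode_4_1 C hk)

/-- Cell `(n, k) = (4, 2)`: every CSS code on `4` qubits with `k = 2` has `min (d^X, d^Z) ≤ 2` — the CSS-CALIB value is optimal among
CSS codes because it is optimal among all additive codes (`noCode_4_2 : ¬ [[4,2,3]]`). [folklore] -/
theorem cssUpper_4_2 {RX RZ : Type*} [Fintype RX] [Fintype RZ] (C : CSSCode RX RZ (Fin 4)) (hk : C.k = 2) :
    min C.dX C.dZ ≤ 2 :=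
  Nat.lt_succ_iff.1 (css_min_dX_dZ_lt_of_not_additiveCodeExists noCode_4_2 C hk)

/-- Cell `(n, k) = (4, 3)`: every CSS code on `4` qubits with `k = 3` has `min (d^X, d^Z) ≤ 1` — the CSS-CALIB value is optimal among
CSS codes because it is optimal among all additive codes (`noCode_4_3 : ¬ [[4,3,2]]`). [folklore] -/
theorem cssUpper_4_3 {RX RZ : Type*} [Fintype RX] [Fintype RZ] (C : CSSCode RX RZ (Fin 4)) (hk : C.k = 3) :
    min C.dX C.dZ ≤ 1 :=
  Nat.lt_succ_iff.1 (css_min_dX_dZ_lt_of_not_additiveCodeExists noCode_4_3 C hk)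

/-- Cell `(n, k) = (4, 4)`: every CSS code on `4` qubits with `k = 4` has `min (d^X, d^Z) ≤ 1` — the CSS-CALIB value is optimal among
CSS codes because it is optimal among all additive codes (`noCode_4_4 : ¬ [[4,4,2]]`). [folklore] -/
theorem cssUpper_4_4 {RX RZ : Type*} [Fintype RX] [Fintype RZ] (C : CSSCode RX RZ (Fin 4)) (hk : C.k = 4) :
    min C.dX C.dZ ≤ 1 :=
  Nat.lt_succ_iff.1 (css_min_dX_dZ_lt_of_not_additiveCodeExists noCode_4_4 C hk)

/-- Cell `(n, k) = (5, 2)`: every CSS code on `5` qubits with `k = 2` has `min (d^X, d^Z) ≤ 2` — the CSS-CALIB value is optimal among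
CSS codes because it is optimal among all additive codes (`noCode_5_2 : ¬ [[5,2,3]]`). [folklore] -/
theorem cssUpper_5_2 {RX RZ : Type*} [Fintype RX] [Fintype RZ] (C : CSSCode RX RZ (Fin 5)) (hk : C.k = 2) :
    min C.dX C.dZ ≤ 2 :=
  Nat.lt_succ_iff.1 (css_min_dX_dZ_lt_of_not_additiveCodeExists noCode_5_2 C hk)

/-- Cell `(n, k) = (5, 3)`: every CSS code on `5` qubits with `k = 3` has `min (d^X, d^Z) ≤ 1` — the CSS-CALIB value is optimal among
CSS codes because it is optimal among all additive codes (`noCode_5_3 : ¬ [[5,3,2]]`). [folklore] -/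
theorem cssUpper_5_3 {RX RZ : Type*} [Fintype RX] [Fintype RZ] (C : CSSCode RX RZ (Fin 5)) (hk : C.k = 3) :
    min C.dX C.dZ ≤ 1 :=
  Nat.lt_succ_iff.1 (css_min_dX_dZ_lt_of_not_additiveCodeExists noCode_5_3 C hk)

/-- Cell `(n, k) = (5, 4)`: every CSS code on `5` qubits with `k = 4` has `min (d^X, d^Z) ≤ 1` — the CSS-CALIB value is optimal among
CSS codes because it is optimal among all additive codes (`noCode_5_4 : ¬ [[5,4,2]]`). [folklore] -/
theorem cssUpper_5_4 {RX RZ : Type*} [Fintype RX] [Fintype RZ] (C : CSSCode RX RZ (Fin 5)) (hk : C.k = 4) :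
    min C.dX C.dZ ≤ 1 :=
  Nat.lt_succ_iff.1 (css_min_dX_dZ_lt_of_not_additiveCodeExists noCode_5_4 C hk)

/-- Cell `(n, k) = (5, 5)`: every CSS code on `5` qubits with `k = 5` has `min (d^X, d^Z) ≤ 1` — the CSS-CALIB value is optimal among
CSS codes because it is optimal among all additive codes (`noCode_5_5 : ¬ [[5,5,2]]`). [folklore] -/
theorem cssUpper_5_5 {RX RZ : Type*} [Fintype RX] [Fintype RZ] (C : CSSCode RX RZ (Fin 5)) (hk : C.k = 5) :
    min C.dX C.dZ ≤ 1 :=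
  Nat.lt_succ_iff.1 (css_min_dX_dZ_lt_of_not_additiveCodeExists noCode_5_5 C hk)

/-- Cell `(n, k) = (6, 2)`: every CSS code on `6` qubits with `k = 2` has `min (d^X, d^Z) ≤ 2` — the CSS-CALIB value is optimal among
CSS codes because it is optimal among all additive codes (`noCode_6_2 : ¬ [[6,2,3]]`). [folklore] -/
theorem cssUpper_6_2 {RX RZ : Type*} [Fintype RX] [Fintype RZ] (C : CSSCode RX RZ (Fin 6)) (hk : C.k = 2) :
    min C.dX C.dZ ≤ 2 :=
  Nat.lt_succ_iff.1 (css_min_dX_dZ_lt_of_not_additiveCodeExists noCode_6_2 C hk)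

/-- Cell `(n, k) = (6, 3)`: every CSS code on `6` qubits with `k = 3` has `min (d^X, d^Z) ≤ 2` — the CSS-CALIB value is optimal among
CSS codes because it is optimal among all additive codes (`noCode_6_3 : ¬ [[6,3,3]]`). [folklore] -/
theorem cssUpper_6_3 {RX RZ : Type*} [Fintype RX] [Fintype RZ] (C : CSSCode RX RZ (Fin 6)) (hk : C.k = 3) :
    min C.dX C.dZ ≤ 2 :=
  Nat.lt_succ_iff.1 (css_min_dX_dZ_lt_of_not_additiveCodeExists noCode_6_3 C hk)

/-- Cell `(n, k) = (6, 4)`: every CSS code on `6` qubits with `k = 4` has `min (d^X, d^Z) ≤ 2` — the CSS-CALIB value is optimal among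
CSS codes because it is optimal among all additive codes (`noCode_6_4 : ¬ [[6,4,3]]`). [folklore] -/
theorem cssUpper_6_4 {RX RZ : Type*} [Fintype RX] [Fintype RZ] (C : CSSCode RX RZ (Fin 6)) (hk : C.k = 4) :
    min C.dX C.dZ ≤ 2 :=
  Nat.lt_succ_iff.1 (css_min_dX_dZ_lt_of_not_additiveCodeExists noCode_6_4 C hk)

/-- Cell `(n, k) = (6, 5)`: every CSS code on `6` qubits with `k = 5` has `min (d^X, d^Z) ≤ 1` — the CSS-CALIB value is optimal among
CSS codes because it is optimal among all additive codes (`noCode_6_5 : ¬ [[6,5,2]]`). [folklore] -/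
theorem cssUpper_6_5 {RX RZ : Type*} [Fintype RX] [Fintype RZ] (C : CSSCode RX RZ (Fin 6)) (hk : C.k = 5) :
    min C.dX C.dZ ≤ 1 :=
  Nat.lt_succ_iff.1 (css_min_dX_dZ_lt_of_not_additiveCodeExists noCode_6_5 C hk)

/-- Cell `(n, k) = (6, 6)`: every CSS code on `6` qubits with `k = 6` has `min (d^X, d^Z) ≤ 1` — the CSS-CALIB value is optimal among
CSS codes because it is optimal among all additive codes (`noCode_6_6 : ¬ [[6,6,2]]`). [folklore] -/
theorem cssUpper_6_6 {RX RZ : Type*} [Fintype RX] [Fintype RZ] (C : CSSCode RX RZ (Fin 6)) (hk : C.k = 6) :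
    min C.dX C.dZ ≤ 1 :=
  Nat.lt_succ_iff.1 (css_min_dX_dZ_lt_of_not_additiveCodeExists noCode_6_6 C hk)

/-- Cell `(n, k) = (7, 1)`: every CSS code on `7` qubits with `k = 1` has `min (d^X, d^Z) ≤ 3` — the CSS-CALIB value is optimal among
CSS codes because it is optimal among all additive codes (`noCode_7_1 : ¬ [[7,1,4]]`). [folklore] -/
theorem cssUpper_7_1 {RX RZ : Type*} [Fintype RX] [Fintype RZ] (C : CSSCode RX RZ (Fin 7)) (hk : C.k = 1) :
    min C.dX C.dZ ≤ 3 :=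
  Nat.lt_succ_iff.1 (css_min_dX_dZ_lt_of_not_additiveCodeExists noCode_7_1 C hk)

/-- Cell `(n, k) = (7, 2)`: every CSS code on `7` qubits with `k = 2` has `min (d^X, d^Z) ≤ 2` — the CSS-CALIB value is optimal among
CSS codes because it is optimal among all additive codes (`noCode_7_2 : ¬ [[7,2,3]]`). [folklore] -/
theorem cssUpper_7_2 {RX RZ : Type*} [Fintype RX] [Fintype RZ] (C : CSSCode RX RZ (Fin 7)) (hk : C.k = 2) :
    min C.dX C.dZ ≤ 2 :=
  Nat.lt_succ_iff.1 (css_min_dX_dZ_lt_of_not_additiveCodeExists noCode_7_2 C hk)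

/-- Cell `(n, k) = (7, 3)`: every CSS code on `7` qubits with `k = 3` has `min (d^X, d^Z) ≤ 2` — the CSS-CALIB value is optimal among
CSS codes because it is optimal among all additive codes (`noCode_7_3 : ¬ [[7,3,3]]`). [folklore] -/
theorem cssUpper_7_3 {RX RZ : Type*} [Fintype RX] [Fintype RZ] (C : CSSCode RX RZ (Fin 7)) (hk : C.k = 3) :
    min C.dX C.dZ ≤ 2 :=
  Nat.lt_succ_iff.1 (css_min_dX_dZ_lt_of_not_additiveCodeExists noCode_7_3 C hk)

/-- Cell `(n, k) = (7, 4)`: every CSS code on `7` qubits with `k = 4` has `min (d^X, d^Z) ≤ 2` — the CSS-CALIB value is optimal among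
CSS codes because it is optimal among all additive codes (`noCode_7_4 : ¬ [[7,4,3]]`). [folklore] -/
theorem cssUpper_7_4 {RX RZ : Type*} [Fintype RX] [Fintype RZ] (C : CSSCode RX RZ (Fin 7)) (hk : C.k = 4) :
    min C.dX C.dZ ≤ 2 :=
  Nat.lt_succ_iff.1 (css_min_dX_dZ_lt_of_not_additiveCodeExists noCode_7_4 C hk)

/-- Cell `(n, k) = (7, 5)`: every CSS code on `7` qubits with `k = 5` has `min (d^X, d^Z) ≤ 1` — the CSS-CALIB value is optimal among
CSS codes because it is optimal among all additive codes (`noCode_7_5 : ¬ [[7,5,2]]`). [folklore] -/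
theorem cssUpper_7_5 {RX RZ : Type*} [Fintype RX] [Fintype RZ] (C : CSSCode RX RZ (Fin 7)) (hk : C.k = 5) :
    min C.dX C.dZ ≤ 1 :=
  Nat.lt_succ_iff.1 (css_min_dX_dZ_lt_of_not_additiveCodeExists noCode_7_5 C hk)

/-- Cell `(n, k) = (7, 6)`: every CSS code on `7` qubits with `k = 6` has `min (d^X, d^Z) ≤ 1` — the CSS-CALIB value is optimal among
CSS codes because it is optimal among all additive codes (`noCode_7_6 : ¬ [[7,6,2]]`). [folklore] -/
theorem cssUpper_7_6 {RX RZ : Type*} [Fintype RX] [Fintype RZ] (C : CSSCode RX RZ (Fin 7)) (hk : C.k = 6) :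
    min C.dX C.dZ ≤ 1 :=
  Nat.lt_succ_iff.1 (css_min_dX_dZ_lt_of_not_additiveCodeExists noCode_7_6 C hk)

/-- Cell `(n, k) = (7, 7)`: every CSS code on `7` qubits with `k = 7` has `min (d^X, d^Z) ≤ 1` — the CSS-CALIB value is optimal among
CSS codes because it is optimal among all additive codes (`noCode_7_7 : ¬ [[7,7,2]]`). [folklore] -/
theorem cssUpper_7_7 {RX RZ : Type*} [Fintype RX] [Fintype RZ] (C : CSSCode RX RZ (Fin 7)) (hk : C.k = 7) :
    min C.dX C.dZ ≤ 1 :=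
  Nat.lt_succ_iff.1 (css_min_dX_dZ_lt_of_not_additiveCodeExists noCode_7_7 C hk)

/-- Cell `(n, k) = (8, 0)`: every zero-rate CSS code on `8` qubits has a nonzero stabilizer of weight `≤ 4` (CRSS `k = 0`
convention; `noCode_8_0 : ¬ [[8,0,5]]`). [folklore] -/
theorem cssUpper_8_0 {RX RZ : Type*} [Fintype RX] [Fintype RZ] (C : CSSCode RX RZ (Fin 8)) (hk : C.k = 0) :
    ∃ v ∈ C.toSympCode, v ≠ 0 ∧ sympWeight v ≤ 4 := by
  obtain ⟨v, hv, hv0, hlt⟩ := css_exists_stabilizer_lt_of_not_additiveCodeExists noCode_8_0 C hk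
  exact ⟨v, hv, hv0, Nat.lt_succ_iff.1 hlt⟩

/-- Cell `(n, k) = (8, 1)`: every CSS code on `8` qubits with `k = 1` has `min (d^X, d^Z) ≤ 3` — the CSS-CALIB value is optimal among
CSS codes because it is optimal among all additive codes (`noCode_8_1 : ¬ [[8,1,4]]`). [folklore] -/
theorem cssUpper_8_1 {RX RZ : Type*} [Fintype RX] [Fintype RZ] (C : CSSCode RX RZ (Fin 8)) (hk : C.k = 1) :
    min C.dX C.dZ ≤ 3 :=
  Nat.lt_succ_iff.1 (css_min_dX_dZ_lt_of_not_additiveCodeExists noCode_8_1 C hk)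

/-- Cell `(n, k) = (8, 4)`: every CSS code on `8` qubits with `k = 4` has `min (d^X, d^Z) ≤ 2` — the CSS-CALIB value is optimal among
CSS codes because it is optimal among all additive codes (`noCode_8_4 : ¬ [[8,4,3]]`). [folklore] -/
theorem cssUpper_8_4 {RX RZ : Type*} [Fintype RX] [Fintype RZ] (C : CSSCode RX RZ (Fin 8)) (hk : C.k = 4) :
    min C.dX C.dZ ≤ 2 :=
  Nat.lt_succ_iff.1 (css_min_dX_dZ_lt_of_not_additiveCodeExists noCode_8_4 C hk)

/-- Cell `(n, k) = (8, 5)`: every CSS code on `8` qubits with `k = 5` has `min (d^X, d^Z) ≤ 2` — the CSS-CALIB value is optimal among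
CSS codes because it is optimal among all additive codes (`noCode_8_5 : ¬ [[8,5,3]]`). [folklore] -/
theorem cssUpper_8_5 {RX RZ : Type*} [Fintype RX] [Fintype RZ] (C : CSSCode RX RZ (Fin 8)) (hk : C.k = 5) :
    min C.dX C.dZ ≤ 2 :=
  Nat.lt_succ_iff.1 (css_min_dX_dZ_lt_of_not_additiveCodeExists noCode_8_5 C hk)

/-- Cell `(n, k) = (8, 6)`: every CSS code on `8` qubits with `k = 6` has `min (d^X, d^Z) ≤ 2` — the CSS-CALIB value is optimal among
CSS codes because it is optimal among all additive codes (`noCode_8_6 : ¬ [[8,6,3]]`). [folklore] -/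
theorem cssUpper_8_6 {RX RZ : Type*} [Fintype RX] [Fintype RZ] (C : CSSCode RX RZ (Fin 8)) (hk : C.k = 6) :
    min C.dX C.dZ ≤ 2 :=
  Nat.lt_succ_iff.1 (css_min_dX_dZ_lt_of_not_additiveCodeExists noCode_8_6 C hk)

/-- Cell `(n, k) = (8, 7)`: every CSS code on `8` qubits with `k = 7` has `min (d^X, d^Z) ≤ 1` — the CSS-CALIB value is optimal among
CSS codes because it is optimal among all additive codes (`noCode_8_7 : ¬ [[8,7,2]]`). [folklore] -/
theorem cssUpper_8_7 {RX RZ : Type*} [Fintype RX] [Fintype RZ] (C : CSSCode RX RZ (Fin 8)) (hk : C.k = 7) :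
    min C.dX C.dZ ≤ 1 :=
  Nat.lt_succ_iff.1 (css_min_dX_dZ_lt_of_not_additiveCodeExists noCode_8_7 C hk)

/-- Cell `(n, k) = (8, 8)`: every CSS code on `8` qubits with `k = 8` has `min (d^X, d^Z) ≤ 1` — the CSS-CALIB value is optimal among
CSS codes because it is optimal among all additive codes (`noCode_8_8 : ¬ [[8,8,2]]`). [folklore] -/
theorem cssUpper_8_8 {RX RZ : Type*} [Fintype RX] [Fintype RZ] (C : CSSCode RX RZ (Fin 8)) (hk : C.k = 8) :
    min C.dX C.dZ ≤ 1 :=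
  Nat.lt_succ_iff.1 (css_min_dX_dZ_lt_of_not_additiveCodeExists noCode_8_8 C hk)

/-! ## The trivial cells `n ≤ 2` (no Table III entry): quantum Singleton bound / `sympWeight ≤ n` -/

/-- Cell `(n, k) = (1, 0)`: every zero-rate CSS code on `1` qubit(s) has a nonzero stabilizer of weight `≤ 1` (trivially:
weights are `≤ n`). [folklore] -/
theorem cssUpper_1_0 {RX RZ : Type*} [Fintype RX] [Fintype RZ] (C : CSSCode RX RZ (Fin 1)) (hk : C.k = 0) :
    ∃ v ∈ C.toSympCode, v ≠ 0 ∧ sympWeight v ≤ 1 :=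
  css_exists_stabilizer_le_card (by norm_num) C hk

/-- Cell `(n, k) = (1, 1)`: `min (d^X, d^Z) ≤ 1` for every CSS code on `1` qubit(s) with `k = 1` — no additive `[[1,1,2]]`
exists by the quantum Singleton bound `k + 2d ≤ n + 2`. [folklore] -/
theorem cssUpper_1_1 {RX RZ : Type*} [Fintype RX] [Fintype RZ] (C : CSSCode RX RZ (Fin 1)) (hk : C.k = 1) :
    min C.dX C.dZ ≤ 1 :=
  Nat.lt_succ_iff.1 (css_min_dX_dZ_lt_of_not_additiveCodeExists
    (fun h => absurd (h.quantumSingleton (by norm_num)) (by norm_num)) C hk)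

/-- Cell `(n, k) = (2, 0)`: every zero-rate CSS code on `2` qubit(s) has a nonzero stabilizer of weight `≤ 2` (trivially:
weights are `≤ n`). [folklore] -/
theorem cssUpper_2_0 {RX RZ : Type*} [Fintype RX] [Fintype RZ] (C : CSSCode RX RZ (Fin 2)) (hk : C.k = 0) :
    ∃ v ∈ C.toSympCode, v ≠ 0 ∧ sympWeight v ≤ 2 :=
  css_exists_stabilizer_le_card (by norm_num) C hk

/-- Cell `(n, k) = (2, 1)`: `min (d^X, d^Z) ≤ 1` for every CSS code on `2` qubit(s) with `k = 1` — no additive `[[2,1,2]]`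
exists by the quantum Singleton bound `k + 2d ≤ n + 2`. [folklore] -/
theorem cssUpper_2_1 {RX RZ : Type*} [Fintype RX] [Fintype RZ] (C : CSSCode RX RZ (Fin 2)) (hk : C.k = 1) :
    min C.dX C.dZ ≤ 1 :=
  Nat.lt_succ_iff.1 (css_min_dX_dZ_lt_of_not_additiveCodeExists
    (fun h => absurd (h.quantumSingleton (by norm_num)) (by norm_num)) C hk)

/-- Cell `(n, k) = (2, 2)`: `min (d^X, d^Z) ≤ 1` for every CSS code on `2` qubit(s) with `k = 2` — no additive `[[2,2,2]]`
exists by the quantum Singleton bound `k + 2d ≤ n + 2`. [folklore] -/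
theorem cssUpper_2_2 {RX RZ : Type*} [Fintype RX] [Fintype RZ] (C : CSSCode RX RZ (Fin 2)) (hk : C.k = 2) :
    min C.dX C.dZ ≤ 1 :=
  Nat.lt_succ_iff.1 (css_min_dX_dZ_lt_of_not_additiveCodeExists
    (fun h => absurd (h.quantumSingleton (by norm_num)) (by norm_num)) C hk)

end Summit.Ventures.QEC.Census.CSS
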